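import Summits.QuantumFields.BalabanUV.Beta.SymCorrectorFace

/-!
# `BalabanUV.Beta.SymCorrectorFaceDiv` — binder row D1, road «BF-x» junction (J1), the `Δ_n` Ward program (an2 R-D1-g43-3 (2)), brick TT7: **THE FACE SUM IS THE BLOCK SUM
# OF THE PURE-GAUGE (DIVERGENCE) VERTICES** — summation by parts on TT3a's signed face sum:
#   **`faceSum n T Y = Σ_{x ∈ blockSitesF n Y} Σ_κ (T κ (x − e_κ) − T κ x)`** (any module-valued bond family `T`), i.e. for kernel families
#   **`faceSum n S Y = Σ_{x ∈ blockSitesF n Y} KernelWard.divV S x`** — the bonds ENTERING the block minus those LEAVING it are the block total of an2's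
#   pure-gauge first-order vertices `divV S x = Σ_κ (S κ (x − e_κ) − S κ x)`; hence a family with a displayed DIVERGENCE (Ward) LAW `divV S x = C x`
#   has face sum `Σ_{x ∈ B(Y)} C x` and face family `S^face α x = faceWt r n α x • Σ_{u ∈ B(blk x)} C u` (`slotPsiS_of_divLaw`).
# This is the bookkeeping half of the OWNER's N-g23-2 (β′) «book the SHEET pieces as COMMUTATOR WORDS through the face Ward identity»: the Ward LETTERS
# (`C x` a commutator ∕ contact kernel — an1's `AveragingWardRootedKernels.vhKerAt_div_left`, L1-B `divV_vhSAt_eq_conjV`, an3's plaquette laws) are the dictionary's;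
# nothing of them is asserted here.

HONEST FRAMING (cell contract, verbatim): «discharging `BetaPertH` makes Bałaban's UV stability UNCONDITIONAL — a real constructive-QFT result; it
is NOT the continuum limit and NOT the Clay problem.»  HONEST DEPENDENCY (verbatim): «continuum YM on T⁴ ⇐ BetaPertH ∧ nine spine estimates (0/9
proved); BetaPertH ⇐ (D1) ∧ (D4) ∧ CAP+tail; G-an2-4 gates asym, D1 and NE2/3/4.»
ABSOLUTE RULE (cell, verbatim): «No internally-minted statement may enter as a cited fact. Every hypothesis is either kernel-proved in this package or a
verbatim quotation of a PUBLISHED theorem with page reference. The manuscript(s) under audit are NOT citable for their own disputed steps — they are the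
thing under adjudication; programme-internal (2001/route/tribunal) claims are never citable.»  NOTHING is cited; no `def`, no `Prop` fact, 0 sorry; [folklore] finite-sum
bookkeeping (`Finset.sum_filter ∕ sum_image`) over the cell's OWN typed objects BY NAME.  Prices NO row; discharges NOTHING of (K), of hW ∕ hR ∕ D1Tel ∕ D1Rep (0∕4), of D1
or of BetaPertH; NOT continuum, NOT Clay.

CONTENT ([folklore]; `d+1` the lattice dimension, `0 < n`): §1 `blk_eq_of_mem_blockSitesF`, `mem_blockSitesF_iff`, `filter_bondNbhd_blk_eq`, `filter_bondNbhd_blk_add_eq`;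
§2 **`faceSum_eq_blockSum_div`**, **`faceSum_eq_blockSum_divV`**; §3 **`faceSum_of_divLaw`**, **`slotPsiS_of_divLaw`**, `faceSum_eq_zero_of_div_eq_zero` (a DIVERGENCE-FREE family has
NO face family: `slotPsiS r n T = T`).
Provenance: D1 formalisation swarm, unit `b2b-balaban-beta-d1-formalise-leaf-03` (gen 29), 2026-08-23; over TT3a BY NAME; no existing file touched.
-/

namespace Summit.QuantumFields.BalabanUV.Beta.SymCorrectorFaceDiv

open Finset
open scoped BigOperators
open Literature.MathematicalPhysics.QuantumFieldTheory
open Literature.MathematicalPhysics.QuantumFieldTheory.Balaban1983to89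
open Literature.MathematicalPhysics.QuantumFieldTheory.Balaban1983to89.Beta
open ExpKernelCalculus (MKer)
open OneStepResolventKernel (Fib)
open KernelWard (divV)
open AffineAveraging (Site box unitVec unitVec_apply)
open AveragingContours (blk)
open Summit.QuantumFields.BalabanUV.Beta.KernelWardRelative (gaugeWt)
open Summit.QuantumFields.BalabanUV.Beta.CompositeCorrectorLocality (blockSitesF mem_blockSitesF_of_blk_eq blk_apply_eq_of_bounds)
open Summit.QuantumFields.BalabanUV.Beta.SymCorrectorFace (b6unitVec_eq gaugeWt_eq bondNbhd faceWt faceSum slotPsiS)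

noncomputable section

variable {d : ℕ} {n : ℕ} (hn : 0 < n)
include hn

/-! ## §1 The block as a `Finset`: membership; the two filters of the face neighbourhood -/

/-- [folklore] A member of `blockSitesF n Y` lies in the block `Y`. -/
theorem blk_eq_of_mem_blockSitesF {Y u : Site (d + 1)} (hu : u ∈ blockSitesF n Y) : blk n u = Y := by
  rw [blockSitesF, Fintype.mem_piFinset] at hu
  funext j
  obtain ⟨h1, h2⟩ := Finset.mem_Icc.1 (hu j)
  exact blk_apply_eq_of_bounds hn h1 (by omega)

/-- [folklore] `u ∈ blockSitesF n Y ↔ blk n u = Y`. -/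
theorem mem_blockSitesF_iff {Y u : Site (d + 1)} : u ∈ blockSitesF n Y ↔ blk n u = Y :=
  ⟨blk_eq_of_mem_blockSitesF hn, mem_blockSitesF_of_blk_eq hn⟩

/-- [folklore] The sites of the face neighbourhood lying IN the block are the block. -/
theorem filter_bondNbhd_blk_eq (Y : Site (d + 1)) (κ : Fin (d + 1)) :
    (bondNbhd n Y κ).filter (fun u => blk n u = Y) = blockSitesF n Y := by
  ext u
  rw [Finset.mem_filter, bondNbhd, Finset.mem_union]
  constructor
  · rintro ⟨-, h⟩; exact mem_blockSitesF_of_blk_eq hn h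
  · intro h; exact ⟨Or.inl h, blk_eq_of_mem_blockSitesF hn h⟩

/-- [folklore] The sites of the face neighbourhood whose `+e_κ` translate lies in the block are the `−e_κ` translates of the block. -/
theorem filter_bondNbhd_blk_add_eq (Y : Site (d + 1)) (κ : Fin (d + 1)) :
    (bondNbhd n Y κ).filter (fun u => blk n (u + unitVec κ) = Y) = (blockSitesF n Y).image (fun x => x - unitVec κ) := by
  ext u
  rw [Finset.mem_filter, Finset.mem_image, bondNbhd, Finset.mem_union, Finset.mem_image]
  constructor
  · rintro ⟨-, h⟩; exact ⟨u + unitVec κ, mem_blockSitesF_of_blk_eq hn h, add_sub_cancel_right _ _⟩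
  · rintro ⟨x, hx, rfl⟩
    refine ⟨Or.inr ⟨x, hx, rfl⟩, ?_⟩
    rw [sub_add_cancel]; exact blk_eq_of_mem_blockSitesF hn hx

/-! ## §2 Summation by parts: the face sum is the block sum of the divergences -/

/-- [folklore] **THE FACE SUM IS THE BLOCK SUM OF THE DIVERGENCES** (module-valued): `faceSum n T Y = Σ_{x ∈ blockSitesF n Y} Σ_κ (T κ (x − e_κ) − T κ x)` —
the bonds entering the block minus those leaving it, re-indexed by the block site they touch. -/
theorem faceSum_eq_blockSum_div {E : Type*} [AddCommGroup E] [Module ℝ E] (T : Fin (d + 1) → Site (d + 1) → E) (Y : Site (d + 1)) :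
    faceSum n T Y = ∑ x ∈ blockSitesF n Y, ∑ κ : Fin (d + 1), (T κ (x - unitVec κ) - T κ x) := by
  classical
  rw [faceSum, Finset.sum_comm]
  refine Finset.sum_congr rfl fun κ _ => ?_
  have e : ∀ u, gaugeWt n Y κ u • T κ u = (if blk n (u + unitVec κ) = Y then T κ u else 0) - (if blk n u = Y then T κ u else 0) := by
    intro u
    rw [gaugeWt_eq, sub_smul]
    congr 1 <;> split_ifs <;> simp
  simp_rw [e]
  rw [Finset.sum_sub_distrib, ← Finset.sum_filter, ← Finset.sum_filter, filter_bondNbhd_blk_add_eq hn, filter_bondNbhd_blk_eq hn,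
    Finset.sum_image fun x _ y _ h => sub_left_injective h, ← Finset.sum_sub_distrib]

/-- [folklore] **FOR KERNEL FAMILIES: `faceSum n S Y = Σ_{x ∈ blockSitesF n Y} divV S x`** — the block total of an2's PURE-GAUGE first-order vertices
`KernelWard.divV S x = Σ_κ (S κ (x − e_κ) − S κ x)` (the two unit-vector conventions agree, TT3a `b6unitVec_eq`). -/
theorem faceSum_eq_blockSum_divV (S : Fin (d + 1) → Site (d + 1) → MKer (d + 1) (Fib d)) (Y : Site (d + 1)) :
    faceSum n S Y = ∑ x ∈ blockSitesF n Y, divV S x := by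
  rw [faceSum_eq_blockSum_div hn]
  refine Finset.sum_congr rfl fun x _ => ?_
  rw [divV]
  refine Finset.sum_congr rfl fun κ _ => ?_
  rw [b6unitVec_eq]

/-! ## §3 Families with a displayed divergence (Ward) law -/

/-- [folklore] **A DIVERGENCE LAW PRICES THE FACE SUM**: `(∀ x, Σ_κ (T κ (x − e_κ) − T κ x) = C x) ⟹ faceSum n T Y = Σ_{x ∈ blockSitesF n Y} C x`. -/
theorem faceSum_of_divLaw {E : Type*} [AddCommGroup E] [Module ℝ E] {T : Fin (d + 1) → Site (d + 1) → E} {C : Site (d + 1) → E}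
    (h : ∀ x, ∑ κ : Fin (d + 1), (T κ (x - unitVec κ) - T κ x) = C x) (Y : Site (d + 1)) :
    faceSum n T Y = ∑ x ∈ blockSitesF n Y, C x := by
  rw [faceSum_eq_blockSum_div hn]
  exact Finset.sum_congr rfl fun x _ => h x

/-- [folklore] **… AND THE FACE FAMILY**: under the same law `slotPsiS r n T α x = T α x + faceWt r n α x • Σ_{u ∈ blockSitesF n (blk n x)} C u` — the slot transport of a
family with a Ward law is the family plus its slot's face weight times the block total of the Ward letters (for kernel families: a block sum of `divV`'s, e.g. COMMUTATOR words). -/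
theorem slotPsiS_of_divLaw {E : Type*} [AddCommGroup E] [Module ℝ E] (r : Fin (d + 1) → ℕ) {T : Fin (d + 1) → Site (d + 1) → E} {C : Site (d + 1) → E}
    (h : ∀ x, ∑ κ : Fin (d + 1), (T κ (x - unitVec κ) - T κ x) = C x) (α : Fin (d + 1)) (x : Site (d + 1)) :
    slotPsiS r n T α x = T α x + faceWt r n α x • ∑ u ∈ blockSitesF n (blk n x), C u := by
  rw [slotPsiS, faceSum_of_divLaw hn h]

/-- [folklore] **A DIVERGENCE-FREE FAMILY HAS NO FACE FAMILY**: `(∀ x, Σ_κ (T κ (x − e_κ) − T κ x) = 0) ⟹ slotPsiS r n T = T` (e.g. exact pure gauges, transversal tables). -/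
theorem slotPsiS_eq_self_of_div_eq_zero {E : Type*} [AddCommGroup E] [Module ℝ E] (r : Fin (d + 1) → ℕ) {T : Fin (d + 1) → Site (d + 1) → E}
    (h : ∀ x, ∑ κ : Fin (d + 1), (T κ (x - unitVec κ) - T κ x) = 0) : slotPsiS r n T = T := by
  funext α x
  rw [slotPsiS_of_divLaw hn r (C := fun _ => (0 : E)) h, Finset.sum_const_zero, smul_zero, add_zero]

end

end Summit.QuantumFields.BalabanUV.Beta.SymCorrectorFaceDiv
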